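import Summits.ResolutionOfSingularities.ResolutionOfSingularities.Theorems.MarkedTransferCampaignW46PlaneIsolated
import HarnessLib

/-!
# [OURS · L1 W4.6 rung (i-b)] «PROCRASTINATION IS THE ONLY OBSTRUCTION ON SURFACES» — statement of the rung and its
# typed corollaries (cell res-hironaka, LADDER-RESOLUTION rung L, D-0089; campaign s46, prover res-L1-s46-pv-1; host route
# MarkedTransfer, `--supports stmt-ResolutionOfSingularities-16155`)

HONEST FRAMING. Nothing here is a statement of H. Hironaka's manuscript (2017-03-23, [Hironaka2017]) and nothing here
asserts that any statement of it holds. Everything is OURS (campaign definitions of cell res-hironaka) or pure logic over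
the OURS typed procedure (`Theorems.MarkedTransferCampaignW46TypedProcedure`, res-L1-type-o1) and the résumé-free reduction
(`MarkedTransferCampaignW46PermissibleReduction`, `…PlaneIsolated`, this seat). The typed candidate carriers enter only as
posited résumés (through `CampaignW46.TerminatesNabla`). AI review is weaker than expert review. No `sorry`; axioms standard.

## Why this rung (RESCUE-SEED W4.6 (i) «surfaces», read on the plane — the non-isolated complement of rung (i-a))

Rung (i) of the W4.6 statement campaign reads «surfaces» as the (REG) candidate `Regime.dimLE 2` of the typed-procedure
module: states `(Z, E)` with `Z` a surface (and `E = (J, b)` an ideal exponent on it). Its map so far: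
* NEGATIVE half (this seat, p473754 / p475556): for every notion instance admitting point plats on singular curves, closed
  points of a CURVE of `Sing(E)` can be blown up forever — `¬ Terminates` / `¬ TerminatesNabla` on `dimLE d`, `d ≥ 2`;
* POSITIVE half so far = rung (i-a) (`PlaneIsolatedPermissiblyTerminates`, closed by name p508559 via Theorem A, and the
  thread-chain theorem p511241): termination when `Sing(E)` stays a FINITE set of closed points.
What is missing between the two is the positive statement for surfaces whose singular locus contains curves. This file
types it: the ONLY way a §2.1-permissible sequence on surfaces can fail to terminate is PROCRASTINATION — blowing up a
closed point lying on a curve of the singular locus (instead of the curve). Formally: every infinite §2.1-permissible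
sequence all of whose stages are surfaces has a procrastinating step (`PlaneNonProcrastinatingTerminates`). Together
with the negative half this closes rung (i) on the plane as a DICHOTOMY in the notion instance: the ∇-centred typed
procedure terminates on surfaces for exactly those notion instances whose terminal plats never isolate a point of a
singular curve (`terminatesNabla_dimLE_two_of_noStrayPoint` below, versus `not_terminatesNabla_dimLE_of_pointPlatCover_plane`).

## Contents

* `PermissibleRun.Procrastinates r k` — step `k` blows up a closed point `ξ` (`D_k = {ξ}`) lying on a curve of
  `Sing(E_k)` (some `η ∈ Sing(E_k)`, `η ≠ ξ`, specialises to `ξ`).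
* `PlaneNonProcrastinatingTerminates p K` — **RUNG (i-b), résumé-free**: no infinite §2.1-permissible sequence on
  surfaces (`Regime.dimLE 2` at every stage; curve centres and point centres both allowed; any field `K` of
  characteristic `p`) avoids procrastination at every step.
* `not_procrastinates_of_isolatedSing`, `planeIsolatedPermissiblyTerminates_of_nonProcrastinating` — rung (i-b) CONTAINS
  rung (i-a): with finite singular locus no step procrastinates.
* `Resumes.NoStrayPoint N Rd` — the hypothesis on a notion instance / reading under which the ∇-centred procedure never
  procrastinates on surfaces: an isolated point of a terminal plat `∇(E)` (a singleton component) is never a point of a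
  curve of `Sing(E)`; `terminatesNabla_dimLE_two_of_noStrayPoint` — **the typed rung**: `PlaneNonProcrastinatingTerminates`
  ⇒ `TerminatesNabla N Rd (Regime.dimLE 2)` for every such `N`, `Rd`.

The PROOF of `PlaneNonProcrastinatingTerminates p K` is the object of the companion files (local layer: the loose
thread-chain theorem `CampaignW46.not_isLooseThreadChain`, `MarkedTransferCampaignW46LooseThread*.lean`; scheme layer to
follow).

## References

* companion modules of this campaign (res-L1-type-o1: TypedProcedure/Anchors; this seat: PermissibleReduction,
  ProcrastinationPlane, ProcrastinationNabla, PlaneIsolated, LooseThread*).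
* H. Hironaka, ms. 2017-03-23, Th. 16.6 p.84 l.4–9, Th. 16.13 p.87 l.26–28, §2.1 p.4 l.34–39 — scope only, under
  adjudication, not cited as fact. [Hironaka2017]
-/

noncomputable section

set_option linter.dupNamespace false -- mandated namespace of this single-conjunct summit

open CategoryTheory AlgebraicGeometry TopologicalSpace

namespace Summit.ResolutionOfSingularities.ResolutionOfSingularities.Theorems

namespace CampaignW46

open Literature.AlgebraicGeometry.Resolution
open Literature.AlgebraicGeometry.Hironaka2017.S02Preliminaries
open Literature.AlgebraicGeometry.Hironaka2017.Datum

universe u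

variable {n : ℕ} {p : ℕ} [Fact p.Prime] {K : Type u} [Field K] [CharP K p]

/-! ## Procrastinating steps -/

namespace PermissibleRun

/-- [OURS · L1 W4.6 rung (i-b)] NOT a statement of the manuscript. **Step `k` of the §2.1-permissible sequence `r`
PROCRASTINATES**: its centre is a single point `ξ` (`D_k = {ξ}`, a closed point since centres are closed) which lies on
a CURVE of the singular locus — some point `η ∈ Sing(E_k)` other than `ξ` specialises to `ξ` (so `ξ` is not an
isolated point of `Sing(E_k)`; on a surface `η` is the generic point of a curve `C ⊆ Sing(E_k)` through `ξ`, and the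
sequence blew up the point `ξ ∈ C` instead of the curve). The move of the negative half of rung (i)
(`exists_procrastinatingStep_at`, p475556). [folklore] -/
def Procrastinates (r : PermissibleRun p K) (k : ℕ) : Prop :=
  ∃ ξ η : (r.A k).Z, (r.D k : Set (r.A k).Z) = {ξ} ∧ η ∈ (r.E k).sing ∧ η ≠ ξ ∧ η ⤳ ξ

end PermissibleRun

/-! ## The rung -/

/-- [OURS · L1 W4.6 rung (i-b)] NOT a statement of the manuscript. **RUNG (i-b), résumé-free — «PROCRASTINATION IS THE
ONLY OBSTRUCTION ON SURFACES»**: replaces the role of the termination clause of Th. 16.13 p.87 l.26–28 («repeatedly but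
finitely many times») for surfaces, in the form the negative half of rung (i) permits: there is NO infinite
§2.1-permissible sequence (standard ideal exponents, permissible centres — regular curves inside `Sing(E)` or closed
points of `Sing(E)` —, blow-ups, controlled transforms) all of whose stages are surfaces (`topologicalKrullDim Z_k ≤ 2`)
and NONE of whose steps procrastinates. Every field `K` of characteristic `p`. Contains rung (i-a)
(`planeIsolatedPermissiblyTerminates_of_nonProcrastinating`). [folklore] -/
def PlaneNonProcrastinatingTerminates (p : ℕ) [Fact p.Prime] (K : Type u) [Field K] [CharP K p] : Prop :=
  ∀ r : PermissibleRun p K, (∀ k, Regime.dimLE 2 (r.A k) (r.E k)) → (∀ k, ¬ r.Procrastinates k) → False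

/-! ## Rung (i-b) contains rung (i-a) -/

/-- In a state with isolated singular locus (`Sing(E)` a finite set of closed points) no step procrastinates: a point
`η ∈ Sing(E)` is closed, so it specialises only to itself. [folklore] -/
theorem PermissibleRun.not_procrastinates_of_isolatedSing (r : PermissibleRun p K) (k : ℕ)
    (hRg : Regime.isolatedSing (r.A k) (r.E k)) : ¬ r.Procrastinates k := by
  rintro ⟨ξ, η, -, hηS, hne, hsp⟩
  obtain ⟨-, hcl⟩ := hRg
  have hηcl : IsClosed ({η} : Set (r.A k).Z) := hcl hηS
  have hmem : ξ ∈ closure ({η} : Set (r.A k).Z) := specializes_iff_mem_closure.mp hsp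
  rw [hηcl.closure_eq, Set.mem_singleton_iff] at hmem
  exact hne hmem.symm

/-- **Rung (i-b) implies rung (i-a).** An infinite permissible sequence in `regimePlaneIsolated` is an infinite
permissible sequence on surfaces without procrastinating steps. [folklore] -/
theorem planeIsolatedPermissiblyTerminates_of_nonProcrastinating (h : PlaneNonProcrastinatingTerminates p K) :
    PlaneIsolatedPermissiblyTerminates p K :=
  fun r hr => h r (fun k => (hr k).1) fun k => r.not_procrastinates_of_isolatedSing k (hr k).2

/-! ## The typed rung: ∇-centred runs of notion instances whose terminal plats isolate no curve point -/

/-- [OURS · L1 W4.6 rung (i-b)] NOT a statement of the manuscript. **The résumés read by `Rd` NEVER ISOLATE A POINT OF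
A SINGULAR CURVE on surfaces**: for every surface state `(A, E)` and every résumé `R` of `E` read by `Rd`, a singleton
component `{ξ}` of the terminal plat `∇(E)` (DESIGN POINT (CMP), `IsNablaComponent`) consists of a point `ξ` to which
no other point of `Sing(E)` specialises — `ξ` lies on no curve of `Sing(E)`. The complementary hypothesis class to the
point-plat covers of the negative half (`PointPlatCover`, p475556), relative to which rung (i) on the plane is a
dichotomy. VACUITY: as (VAC) in the typed-procedure module — contentful exactly for the named notion instances of
the rung files; junk instances may satisfy or violate it. [folklore] -/
def Resumes.NoStrayPoint (N : Notions.{u} n) (Rd : Reading p K N) : Prop :=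
  ∀ (A : AmbientDatum p K) (E : IdealExponent A.Z) (R : Resume N A E), Rd A E R → Regime.dimLE 2 A E →
    ∀ (D : Closeds A.Z), IsNablaComponent R D → ∀ ξ : A.Z, (D : Set A.Z) = {ξ} →
      ∀ η ∈ E.sing, η ⤳ ξ → η = ξ

/-- A ∇-centred run of a notion instance whose résumés never isolate a point of a singular curve does not
procrastinate (on surface stages): its centres are components of the terminal plats. [folklore] -/
theorem RunNabla.not_procrastinates_of_noStrayPoint {N : Notions.{u} n} {Rd : Reading p K N}
    (hN : Resumes.NoStrayPoint N Rd) (r : RunNabla N Rd) (k : ℕ) (hdim : Regime.dimLE 2 (r.A k) (r.E k)) :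
    ¬ r.toRun.toPermissibleRun.Procrastinates k := by
  rintro ⟨ξ, η, hD, hηS, hne, hsp⟩
  exact hne (hN (r.A k) (r.E k) (r.R k) (r.reads k) hdim (r.step k).toStep.D (r.step k).component ξ hD η hηS hsp)

/-- **THE TYPED RUNG (i-b).** [OURS · L1 W4.6 rung (i-b)] NOT a statement of the manuscript. If procrastination is the
only obstruction on surfaces (`PlaneNonProcrastinatingTerminates p K`), then the ∇-CENTRED typed Th. 16.6 procedure
terminates on surfaces (`TerminatesNabla N Rd (Regime.dimLE 2)`) for EVERY notion instance `N` and reading `Rd` whose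
résumés never isolate a point of a singular curve (`Resumes.NoStrayPoint N Rd`). With the negative half
(`not_terminatesNabla_dimLE_of_pointPlatCover_plane`, p475556: point-plat covers ⇒ `¬ TerminatesNabla`) this is the
dichotomy of rung (i) on the plane. [folklore] -/
theorem terminatesNabla_dimLE_two_of_noStrayPoint (h : PlaneNonProcrastinatingTerminates p K)
    {N : Notions.{u} n} {Rd : Reading p K N} (hN : Resumes.NoStrayPoint N Rd) :
    TerminatesNabla N Rd (Regime.dimLE 2 (p := p) (K := K)) :=
  fun r hr => h r.toRun.toPermissibleRun hr fun k => r.not_procrastinates_of_noStrayPoint hN k (hr k)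

end CampaignW46

end Summit.ResolutionOfSingularities.ResolutionOfSingularities.Theorems

end
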